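import Summits.ResolutionOfSingularities.ResolutionOfSingularities.Theorems.HilbertSamuelEliminationCampaignW42TertiaryElimination
import Literature.AlgebraicGeometry.Resolution.AlterationsNormalFormStrictTransform
import Literature.AlgebraicGeometry.Resolution.AlterationsNormalFormStrictTransformProofs
import Literature.AlgebraicGeometry.Resolution.IdealSheafDescent
import HarnessLib

/-!
# [OURS · L1 W4.2] Liveness of `S(X, ν)`: the canonical sequence is never stuck once the oracle answers on the
# strata and replayed strict transforms embed (GW Prop. 13.96 (2)) — so O2 + lower-dimensional resolution give the
# `ν`-modification of an isolated maximal stratum (`--supports stmt-ResolutionOfSingularities-17846`)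

OURS (slot W4.2 of cell res-hironaka, LADDER-RESOLUTION rung L, D-0089; prover seat res-L1-s42-pv-2, gen 2); NOT
statements of H. Hironaka's manuscript [Hironaka2017]; nothing of the manuscript is used or asserted. AI review is
weaker than expert review. Pure PROOF file; no new definition — hypotheses are spelled inline.

The Elimination file (`…CampaignW42TertiaryElimination.lean`) proved `TertiaryTermination p ⇒ TameWild.NuMod X N d ν`
at isolated maximal strata MODULO two inline hypotheses on the oracle `R`: LIVENESS of `S(X, ν)` (every canonical run
with non-empty last `ν`-stratum is prolonged) and permissible canonical centres in the strata. This file DISCHARGES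
LIVENESS structurally, following CJS Rem. 6.29 (1) step by step:

* `exists_isCanonicalStep_of_total` — FROM A GOOD STATE A CANONICAL STEP EXISTS as soon as (i) the oracle ANSWERS on
  the reduced closed subschemes `V(𝓘_Z)`, `Z ⊆ X_n(ν)` closed non-empty (for the intended oracle: the canonical
  resolution sequence of the lower-dimensional `Y_n^{(j)}` exists — CJS's induction on dimension), and (ii) replayed
  strict transforms embed: the tree's NAMED FACT `StrictTransformClosedImmersion` (Görtz–Wedhorn I, Prop. 13.96 (2):
  `Bl_{Y∩Z}(Y) → Bl_Z(X)` is a closed immersion; the morphism itself is the tree's `IsBlowup.strictTransformHom`,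
  Prop. 13.91 (1)). Between cycles the least non-empty label `j` exists (`Labelling.exists_isLeast_part_nonempty`),
  `Y_n^{(j)}` is closed (Noetherian stage, closed stratum: `StateGood`, p477843), and the first replay step is formed;
  inside a cycle the next replay step is formed likewise.
* `exists_isCanonicalRunFrom_succ_of_total` — hence every canonical run from a good state with non-empty last stratum
  is prolonged (induction along the run; good states propagate, `StateGood.next`).
* `live_of_total` — LIVENESS OF `S(X, ν)` AT AN ISOLATED ORIGIN of characteristic `p` with permissible canonical
  centres, from (i) and (ii).
* `nuMod_of_tertiaryTermination_of_total` — THE HEADLINE WITH LIVENESS DISCHARGED: `TertiaryTermination p`, the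
  oracle's answers on the strata, GW 13.96 (2), and permissible canonical centres in the strata give
  `TameWild.NuMod X N d ν` for every isolated maximal stratum `X(ν) = {x}` of a reduced finite-type `X/k` of
  characteristic `p`, `dim X ≤ d`, `dim X ≤ N` — in every dimension.

HONEST STATUS of the inputs: `StrictTransformClosedImmersion` (textbook, GW 13.96 (2)) is a named fact of the tree
which IS DISCHARGED there (`StrictTransformClosedImmersion_holds`, `AlterationsNormalFormStrictTransformProofs.lean`, via
`IsBlowup.isClosedImmersion_of_comp_eq`): the theorems of the first sections take it as a hypothesis `hST` (so they
read chart-free), and the final section «Unconditional forms» (appended 2026-08-27, same seat) instantiates `hST` with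
the tree's proof — those forms rest on NO named fact. The oracle's answers are the induction-on-dimension input (in
dimension `≤ 3` they come from resolution of excellent surfaces, CJS Thm. 1.2 / tree named fact
`CossartJannsenSaito2020SequencePermissible`, once the strata parts are known to have dimension `≤ 2`); O2
(`TertiaryTermination p`) is OPEN.

## References

* V. Cossart, U. Jannsen, S. Saito, LNM 2270 (2020), Rem. 6.29 (1) pp. 91–92, proof of Thm. 6.28 Steps 4–7
  pp. 94–95, p. 100, p. 102. [CossartJannsenSaito2020]
* U. Görtz, T. Wedhorn, *Algebraic Geometry I* (2nd ed. 2020), Prop. 13.91 (1), Prop. 13.96 (2). [GortzWedhorn2020]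
-/

noncomputable section

set_option linter.dupNamespace false -- mandated namespace of this single-conjunct summit

open CategoryTheory AlgebraicGeometry TopologicalSpace Topology

namespace Summit.ResolutionOfSingularities.ResolutionOfSingularities.Theorems

namespace CampaignW42

open Literature.AlgebraicGeometry.Resolution Literature.RingTheory.HilbertSamuel
open Summit.ResolutionOfSingularities.ResolutionOfSingularities.Theorems.SigmaMaxModificationsCorridor3

universe u

variable {p : ℕ} {R : ∀ S : Scheme.{u}, CentreSeq S → Prop} {N : ℕ} {ν : ℕ → ℕ}
variable {k : Type u} [Field k]

/-! ## One replay step always exists (modulo GW 13.96 (2)) -/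

/-- **A REPLAY STEP EXISTS** for every label `j`, closed immersion `φ : S ⟶ W` and sequence `t` on `S`, provided the
parts of the stratum are closed and replayed strict transforms embed (GW Prop. 13.96 (2)): if `t` is exhausted the
centre is the reduced `Y^{(j)}` and the cycle ends; otherwise the centre is the push-forward `D.map φ` of the next
centre `D` of `t`, and `Bl(φ) : Bl_D(S) → Bl_{φ_* D}(W)` (tree `IsBlowup.strictTransformHom`, over `φ` since
`φ⁻¹(φ_* D) = D`, `comap_map_of_isClosedImmersion`) carries the cycle on.
[cite: CossartJannsenSaito2020, Rem. 6.29 (1)] [cite: GortzWedhorn2020, Prop. 13.91 (1), Prop. 13.96 (2)] -/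
theorem exists_isReplayStep (hST : StrictTransformClosedImmersion.{u}) {W : Scheme.{u}} (L : Labelling W)
    {Y : Set W} (hpart : ∀ i, IsClosed (L.part Y i)) (j : ℕ) {S : Scheme.{u}} (φ : S ⟶ W)
    [IsClosedImmersion φ] (t : CentreSeq S) :
    ∃ (C : W.IdealSheafData) (P' : Option (Pending (blowup C))), IsReplayStep L Y j φ t C P' := by
  cases t with
  | nil _ =>
    exact ⟨Scheme.IdealSheafData.vanishingIdeal ⟨L.part Y j, hpart j⟩, none, ⟨hpart j, rfl⟩, rfl⟩
  | cons D t' =>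
    have hρ : IsBlowup (blowup.π D) ((D.map φ).comap φ) := by
      rw [comap_map_of_isClosedImmersion]
      exact blowup.isBlowup D
    have hcomp : (blowup.isBlowup (D.map φ)).strictTransformHom hρ ≫ blowup.π (D.map φ) = blowup.π D ≫ φ :=
      (blowup.isBlowup (D.map φ)).strictTransformHom_comp hρ
    have hφ' : IsClosedImmersion ((blowup.isBlowup (D.map φ)).strictTransformHom hρ) :=
      hST W (blowup (D.map φ)) S (blowup D) (D.map φ) φ (blowup.π (D.map φ)) (blowup.π D)
        (blowup.isBlowup _) hρ _ hcomp
    exact ⟨D.map φ, some ⟨j, blowup D, _, hφ', t'⟩, rfl, _, hφ', hcomp, rfl⟩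

/-! ## A canonical step exists from a good state whose stratum is non-empty -/

/-- **FROM A GOOD STATE WITH NON-EMPTY `ν`-STRATUM A CANONICAL STEP EXISTS**, provided (i) the oracle answers on the
reduced closed subschemes `V(𝓘_Z)` of the closed non-empty `Z ⊆ X_n(ν)` (used between cycles, on the least non-empty
`Y_n^{(j)}`), and (ii) replayed strict transforms embed (GW Prop. 13.96 (2)). The stage is Noetherian with closed
stratum (`StateGood`), so the parts `Y_n^{(i)}` are closed (finitely many irreducible components).
[cite: CossartJannsenSaito2020, Rem. 6.29 (1), proof of Thm. 6.28 Step 7] [cite: GortzWedhorn2020, Prop. 13.96 (2)] -/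
theorem exists_isCanonicalStep_of_total (hST : StrictTransformClosedImmersion.{u}) {W : Scheme.{u}}
    {L : Labelling W} {P : Option (Pending W)} (hg : StateGood k R N ν W L P)
    (hY : (Scheme.hsStratum W N ν).Nonempty)
    (htotal : ∀ (Z : Set W) (hZ : IsClosed Z), Z ⊆ Scheme.hsStratum W N ν → Z.Nonempty →
      ∃ t, R (Scheme.IdealSheafData.vanishingIdeal ⟨Z, hZ⟩).subscheme t) :
    ∃ (C : W.IdealSheafData) (P' : Option (Pending (blowup C))), IsCanonicalStep R N ν L P C P' := by
  haveI := hg.isLocallyNoetherian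
  haveI := hg.isNoetherian
  have hpart : ∀ i, IsClosed (L.part (Scheme.hsStratum W N ν) i) :=
    L.isClosed_part hg.isClosed_hsStratum (componentsIn.finite _)
  cases P with
  | none =>
    obtain ⟨j, hj⟩ := L.exists_isLeast_part_nonempty hY
    obtain ⟨t, ht⟩ := htotal _ (hpart j) (L.part_subset _ j) hj.1
    obtain ⟨C, P', hs⟩ := exists_isReplayStep hST L hpart j
      (Scheme.IdealSheafData.vanishingIdeal ⟨_, hpart j⟩).subschemeι t
    exact ⟨C, P', j, hj, hpart j, t, ht, hs⟩
  | some Q =>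
    haveI := Q.isClosedImmersion
    obtain ⟨C, P', hs⟩ := exists_isReplayStep hST L hpart Q.lbl Q.hom Q.rest
    exact ⟨C, P', hY, hs⟩

/-- **EVERY CANONICAL RUN FROM A GOOD STATE WITH NON-EMPTY LAST `ν`-STRATUM IS PROLONGED** (same provisos, the oracle's
answers being asked on the LAST stage): induction along the run, good states propagate (`StateGood.next`).
[cite: CossartJannsenSaito2020, Rem. 6.29 (1)] -/
theorem exists_isCanonicalRunFrom_succ_of_total (hST : StrictTransformClosedImmersion.{u}) :
    ∀ {W : Scheme.{u}} {L : Labelling W} {P : Option (Pending W)}, StateGood k R N ν W L P →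
      ∀ (s : CentreSeq W), IsCanonicalRunFrom R N ν L P s → (Scheme.hsStratum s.top N ν).Nonempty →
        (∀ (Z : Set s.top) (hZ : IsClosed Z), Z ⊆ Scheme.hsStratum s.top N ν → Z.Nonempty →
          ∃ t, R (Scheme.IdealSheafData.vanishingIdeal ⟨Z, hZ⟩).subscheme t) →
        ∃ s' : CentreSeq W, IsCanonicalRunFrom R N ν L P s' ∧ s'.length = s.length + 1
  | W, L, P, hg, CentreSeq.nil _, _, hY, htotal => by
    obtain ⟨C, P', hst⟩ := exists_isCanonicalStep_of_total hST hg hY htotal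
    exact ⟨CentreSeq.cons C (CentreSeq.nil _), ⟨P', hst, trivial⟩, rfl⟩
  | W, L, P, hg, CentreSeq.cons C rest, hs, hY, htotal => by
    obtain ⟨P', hst, hrest⟩ := hs
    obtain ⟨rest', hrest', hlen⟩ :=
      exists_isCanonicalRunFrom_succ_of_total hST (hg.next hst) rest hrest hY htotal
    exact ⟨CentreSeq.cons C rest', ⟨P', hst, hrest'⟩, by simp [hlen]⟩

/-! ## Liveness at an isolated origin; the headline with liveness discharged -/

/-- **`S(X, ν)` IS LIVE AT AN ISOLATED ORIGIN** of characteristic `p` whose canonical centres are permissible, once the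
oracle answers on the reduced closed non-empty subsets of the `ν`-strata of the stages reached and replayed strict
transforms embed (GW Prop. 13.96 (2)). [cite: CossartJannsenSaito2020, Rem. 6.29 (1)] [cite: GortzWedhorn2020, Prop. 13.96 (2)] -/
theorem live_of_total (hST : StrictTransformClosedImmersion.{u}) {X : Scheme.{u}} [IsLocallyNoetherian X] {x : X}
    (hX : IsIsolatedOrigin p N ν X x) (hperm : ∀ t : CentreSeq X, t.IsCanonicalRun R N ν → t.AllPermissible)
    (htotal : ∀ s : CentreSeq X, s.IsCanonicalRun R N ν → ∀ (Z : Set s.top) (hZ : IsClosed Z),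
      Z ⊆ Scheme.hsStratum s.top N ν → Z.Nonempty →
        ∃ t, R (Scheme.IdealSheafData.vanishingIdeal ⟨Z, hZ⟩).subscheme t)
    (s : CentreSeq X) (hs : s.IsCanonicalRun R N ν) (hY : (Scheme.hsStratum s.top N ν).Nonempty) :
    ∃ s' : CentreSeq X, s'.IsCanonicalRun R N ν ∧ s'.length = s.length + 1 := by
  obtain ⟨k, _, _, f, -, hft, hqc⟩ := hX.exists_structure
  have hsup : ∀ w : X, ν ≤ Scheme.hsFun X N w → Scheme.hsFun X N w = ν :=
    fun w hw => le_antisymm (hX.maximal.2 ⟨w, rfl⟩ hw) hw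
  have hgood : StateGood k R N ν X (Labelling.init X) none := ⟨⟨f, hft, hqc⟩, hX.dim_le, hsup, hperm⟩
  exact exists_isCanonicalRunFrom_succ_of_total hST hgood s hs hY (htotal s hs)

/-- **THE HEADLINE WITH LIVENESS DISCHARGED — `TertiaryTermination p ⇒ ν-MODIFICATION OF EVERY ISOLATED MAXIMAL
STRATUM`, in every dimension:** for `X` reduced of finite type over a field of characteristic `p`, `dim X ≤ d`,
`dim X ≤ N`, `ν ∈ Σ_X(N)^max`, `X(ν) = {x}` with `x` closed (all in `IsIsolatedOrigin`), a functional admissible oracle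
`R` which ANSWERS on the reduced closed non-empty subsets of the `ν`-strata met along `S(X, ν)` (induction on
dimension) and whose canonical centres are permissible and lie in the strata (CJS p. 92 / Lemma 5.34 (3)), and
replayed strict transforms embedding (GW Prop. 13.96 (2), named fact): `TameWild.NuMod X N d ν`. CONDITIONAL on the
named fact `StrictTransformClosedImmersion`; O2 enters as the hypothesis `TertiaryTermination p`.
[cite: CossartJannsenSaito2020, Def. 6.14, Rem. 6.29 (1), p. 92, p. 107] [cite: GortzWedhorn2020, Prop. 13.96 (2)] -/
theorem nuMod_of_tertiaryTermination_of_total {p : ℕ} (h : TertiaryTermination.{0} p)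
    (hST : StrictTransformClosedImmersion.{0}) {R : ∀ S : Scheme.{0}, CentreSeq S → Prop} {N : ℕ} {ν : ℕ → ℕ}
    (hRf : OracleFunctional R) (hRa : OracleAdmissible R) {X : Scheme.{0}} [IsLocallyNoetherian X] {x : X}
    (hX : IsIsolatedOrigin p N ν X x) {d : ℕ} (hdimd : topologicalKrullDim X ≤ (d : WithBot ℕ∞))
    (hcent : ∀ t : CentreSeq X, t.IsCanonicalRun R N ν → t.AllPermissible ∧ t.CentresInStratum N ν)
    (htotal : ∀ s : CentreSeq X, s.IsCanonicalRun R N ν → ∀ (Z : Set s.top) (hZ : IsClosed Z),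
      Z ⊆ Scheme.hsStratum s.top N ν → Z.Nonempty →
        ∃ t, R (Scheme.IdealSheafData.vanishingIdeal ⟨Z, hZ⟩).subscheme t) :
    TameWild.NuMod X N d ν :=
  nuMod_of_tertiaryTermination h hRf hRa hX hdimd hcent
    (live_of_total hST hX (fun t ht => (hcent t ht).1) htotal)

/-- **The existential-oracle form with liveness discharged:** one functional admissible oracle answering on the
strata, with permissible canonical centres in the strata and WITHOUT an infinite near chain from `(X, x)`, gives
`TameWild.NuMod X N d ν` (conditional on GW 13.96 (2)). [cite: CossartJannsenSaito2020, Def. 6.14, Rem. 6.29 (1)] -/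
theorem nuMod_of_noNearChain_of_total {p : ℕ} (hST : StrictTransformClosedImmersion.{0})
    {R : ∀ S : Scheme.{0}, CentreSeq S → Prop} {N : ℕ} {ν : ℕ → ℕ} (hRf : OracleFunctional R)
    {X : Scheme.{0}} [IsLocallyNoetherian X] {x : X} (hX : IsIsolatedOrigin p N ν X x) {d : ℕ}
    (hdimd : topologicalKrullDim X ≤ (d : WithBot ℕ∞))
    (hcent : ∀ t : CentreSeq X, t.IsCanonicalRun R N ν → t.AllPermissible ∧ t.CentresInStratum N ν)
    (htotal : ∀ s : CentreSeq X, s.IsCanonicalRun R N ν → ∀ (Z : Set s.top) (hZ : IsClosed Z),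
      Z ⊆ Scheme.hsStratum s.top N ν → Z.Nonempty →
        ∃ t, R (Scheme.IdealSheafData.vanishingIdeal ⟨Z, hZ⟩).subscheme t)
    (hno : NoNearChainFrom R N ν (MarkedStage.init X x) fun _ => True) : TameWild.NuMod X N d ν :=
  nuMod_of_noNearChain hRf hX hdimd hcent (live_of_total hST hX (fun t ht => (hcent t ht).1) htotal) hno

/-- **At an isolated origin whose oracle answers on the strata (and GW 13.96 (2)), the three renderings of «the
procedure ends» coincide:** no infinite near chain from the initial marked stage ⟺ `S(X, ν)` terminates ⟺ `S(X, ν)`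
is not infinite (functional oracle, permissible canonical centres). [cite: CossartJannsenSaito2020, Rem. 6.29 (1), p. 107] -/
theorem noNearChain_iff_terminates_iff_not_infinite_of_total (hST : StrictTransformClosedImmersion.{u})
    (hRf : OracleFunctional R) {X : Scheme.{u}} [IsLocallyNoetherian X] {x : X} (hX : IsIsolatedOrigin p N ν X x)
    (hperm : ∀ t : CentreSeq X, t.IsCanonicalRun R N ν → t.AllPermissible)
    (htotal : ∀ s : CentreSeq X, s.IsCanonicalRun R N ν → ∀ (Z : Set s.top) (hZ : IsClosed Z),
      Z ⊆ Scheme.hsStratum s.top N ν → Z.Nonempty →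
        ∃ t, R (Scheme.IdealSheafData.vanishingIdeal ⟨Z, hZ⟩).subscheme t) :
    ((NoNearChainFrom R N ν (MarkedStage.init X x) fun _ => True) ↔ CanonicalSequenceTerminates R N ν X) ∧
      (CanonicalSequenceTerminates R N ν X ↔ ¬ CanonicalSequenceInfinite R N ν X) :=
  have hlive := live_of_total hST hX hperm htotal
  ⟨noNearChain_init_iff_canonicalSequenceTerminates hRf hX hperm hlive,
    ⟨fun ht => ht.not_infinite hRf, canonicalSequenceTerminates_of_live_of_not_infinite hlive⟩⟩

/-! ## Unconditional forms: GW Prop. 13.96 (2) is PROVED in the tree (`StrictTransformClosedImmersion_holds`)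

Appended 2026-08-27 (same seat, gen 2). The named fact `StrictTransformClosedImmersion` is discharged in
`Literature/AlgebraicGeometry/Resolution/AlterationsNormalFormStrictTransformProofs.lean` (chart-by-chart proof of
GW p. 416, `IsBlowup.isClosedImmersion_of_comp_eq`), so every `hST` above can be supplied: the forms below depend on no
undischarged named fact (axioms `propext`, `Classical.choice`, `Quot.sound`). -/

/-- A replay step ALWAYS exists (labels' parts closed): unconditional form of `exists_isReplayStep`.
[cite: CossartJannsenSaito2020, Rem. 6.29 (1)] [cite: GortzWedhorn2020, Prop. 13.96 (2)] -/
theorem exists_isReplayStep' {W : Scheme.{u}} (L : Labelling W) {Y : Set W} (hpart : ∀ i, IsClosed (L.part Y i))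
    (j : ℕ) {S : Scheme.{u}} (φ : S ⟶ W) [IsClosedImmersion φ] (t : CentreSeq S) :
    ∃ (C : W.IdealSheafData) (P' : Option (Pending (blowup C))), IsReplayStep L Y j φ t C P' :=
  exists_isReplayStep StrictTransformClosedImmersion_holds L hpart j φ t

/-- **A CANONICAL STEP EXISTS from a good state with non-empty `ν`-stratum as soon as the oracle answers on the
reduced closed non-empty subsets of the stratum** — unconditional form of `exists_isCanonicalStep_of_total`.
[cite: CossartJannsenSaito2020, Rem. 6.29 (1), proof of Thm. 6.28 Step 7] -/
theorem exists_isCanonicalStep_of_answers {W : Scheme.{u}} {L : Labelling W} {P : Option (Pending W)}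
    (hg : StateGood k R N ν W L P) (hY : (Scheme.hsStratum W N ν).Nonempty)
    (htotal : ∀ (Z : Set W) (hZ : IsClosed Z), Z ⊆ Scheme.hsStratum W N ν → Z.Nonempty →
      ∃ t, R (Scheme.IdealSheafData.vanishingIdeal ⟨Z, hZ⟩).subscheme t) :
    ∃ (C : W.IdealSheafData) (P' : Option (Pending (blowup C))), IsCanonicalStep R N ν L P C P' :=
  exists_isCanonicalStep_of_total StrictTransformClosedImmersion_holds hg hY htotal

/-- **`S(X, ν)` IS LIVE AT AN ISOLATED ORIGIN whose canonical centres are permissible, as soon as the oracle answers on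
the reduced closed non-empty subsets of the `ν`-strata met** — unconditional form of `live_of_total`: the ONLY input is
the lower-dimensional one (the oracle's answers). [cite: CossartJannsenSaito2020, Rem. 6.29 (1)] -/
theorem live_of_answers {X : Scheme.{u}} [IsLocallyNoetherian X] {x : X} (hX : IsIsolatedOrigin p N ν X x)
    (hperm : ∀ t : CentreSeq X, t.IsCanonicalRun R N ν → t.AllPermissible)
    (htotal : ∀ s : CentreSeq X, s.IsCanonicalRun R N ν → ∀ (Z : Set s.top) (hZ : IsClosed Z),
      Z ⊆ Scheme.hsStratum s.top N ν → Z.Nonempty →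
        ∃ t, R (Scheme.IdealSheafData.vanishingIdeal ⟨Z, hZ⟩).subscheme t)
    (s : CentreSeq X) (hs : s.IsCanonicalRun R N ν) (hY : (Scheme.hsStratum s.top N ν).Nonempty) :
    ∃ s' : CentreSeq X, s'.IsCanonicalRun R N ν ∧ s'.length = s.length + 1 :=
  live_of_total StrictTransformClosedImmersion_holds hX hperm htotal s hs hY

/-- **THE HEADLINE, UNCONDITIONAL IN THE TREE — `TertiaryTermination p ⇒ ν-MODIFICATION OF EVERY ISOLATED MAXIMAL
STRATUM`, in every dimension:** `X` reduced of finite type over a field of characteristic `p`, `dim X ≤ d`,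
`dim X ≤ N`, `ν ∈ Σ_X(N)^max`, `X(ν) = {x}` with `x` closed; `R` a functional admissible oracle which answers on the
reduced closed non-empty subsets of the `ν`-strata met along `S(X, ν)` (the induction-on-dimension input) and whose
canonical centres are permissible and lie in the strata (CJS p. 92 / Lemma 5.34 (3)). Then `TameWild.NuMod X N d ν`.
Beyond the two displayed inputs the only hypothesis is O2 itself, `TertiaryTermination p`.
[cite: CossartJannsenSaito2020, Def. 6.14, Rem. 6.29 (1), p. 92, p. 107] -/
theorem nuMod_of_tertiaryTermination_of_answers {p : ℕ} (h : TertiaryTermination.{0} p)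
    {R : ∀ S : Scheme.{0}, CentreSeq S → Prop} {N : ℕ} {ν : ℕ → ℕ} (hRf : OracleFunctional R)
    (hRa : OracleAdmissible R) {X : Scheme.{0}} [IsLocallyNoetherian X] {x : X} (hX : IsIsolatedOrigin p N ν X x)
    {d : ℕ} (hdimd : topologicalKrullDim X ≤ (d : WithBot ℕ∞))
    (hcent : ∀ t : CentreSeq X, t.IsCanonicalRun R N ν → t.AllPermissible ∧ t.CentresInStratum N ν)
    (htotal : ∀ s : CentreSeq X, s.IsCanonicalRun R N ν → ∀ (Z : Set s.top) (hZ : IsClosed Z),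
      Z ⊆ Scheme.hsStratum s.top N ν → Z.Nonempty →
        ∃ t, R (Scheme.IdealSheafData.vanishingIdeal ⟨Z, hZ⟩).subscheme t) :
    TameWild.NuMod X N d ν :=
  nuMod_of_tertiaryTermination_of_total h StrictTransformClosedImmersion_holds hRf hRa hX hdimd hcent htotal

/-- **The existential-oracle form, unconditional in the tree:** ONE functional admissible oracle answering on the
strata, with permissible canonical centres in the strata and no infinite near chain from `(X, x)`, gives
`TameWild.NuMod X N d ν`. [cite: CossartJannsenSaito2020, Def. 6.14, Rem. 6.29 (1)] -/
theorem nuMod_of_noNearChain_of_answers {p : ℕ} {R : ∀ S : Scheme.{0}, CentreSeq S → Prop} {N : ℕ} {ν : ℕ → ℕ}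
    (hRf : OracleFunctional R) {X : Scheme.{0}} [IsLocallyNoetherian X] {x : X} (hX : IsIsolatedOrigin p N ν X x)
    {d : ℕ} (hdimd : topologicalKrullDim X ≤ (d : WithBot ℕ∞))
    (hcent : ∀ t : CentreSeq X, t.IsCanonicalRun R N ν → t.AllPermissible ∧ t.CentresInStratum N ν)
    (htotal : ∀ s : CentreSeq X, s.IsCanonicalRun R N ν → ∀ (Z : Set s.top) (hZ : IsClosed Z),
      Z ⊆ Scheme.hsStratum s.top N ν → Z.Nonempty →
        ∃ t, R (Scheme.IdealSheafData.vanishingIdeal ⟨Z, hZ⟩).subscheme t)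
    (hno : NoNearChainFrom R N ν (MarkedStage.init X x) fun _ => True) : TameWild.NuMod X N d ν :=
  nuMod_of_noNearChain_of_total StrictTransformClosedImmersion_holds hRf hX hdimd hcent htotal hno

/-- **The three renderings of «the procedure ends» coincide** at an isolated origin whose oracle answers on the strata
(functional oracle, permissible canonical centres) — unconditional form. [cite: CossartJannsenSaito2020, Rem. 6.29 (1), p. 107] -/
theorem noNearChain_iff_terminates_iff_not_infinite_of_answers (hRf : OracleFunctional R) {X : Scheme.{u}}
    [IsLocallyNoetherian X] {x : X} (hX : IsIsolatedOrigin p N ν X x)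
    (hperm : ∀ t : CentreSeq X, t.IsCanonicalRun R N ν → t.AllPermissible)
    (htotal : ∀ s : CentreSeq X, s.IsCanonicalRun R N ν → ∀ (Z : Set s.top) (hZ : IsClosed Z),
      Z ⊆ Scheme.hsStratum s.top N ν → Z.Nonempty →
        ∃ t, R (Scheme.IdealSheafData.vanishingIdeal ⟨Z, hZ⟩).subscheme t) :
    ((NoNearChainFrom R N ν (MarkedStage.init X x) fun _ => True) ↔ CanonicalSequenceTerminates R N ν X) ∧
      (CanonicalSequenceTerminates R N ν X ↔ ¬ CanonicalSequenceInfinite R N ν X) :=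
  noNearChain_iff_terminates_iff_not_infinite_of_total StrictTransformClosedImmersion_holds hRf hX hperm htotal

end CampaignW42

end Summit.ResolutionOfSingularities.ResolutionOfSingularities.Theorems

end
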